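import Mathlib
import HarnessLib
import Summits.HubbardSuperconductivity.HubbardSuperconductivity.Theorems.KLProgrammeC4aCausticWindowDispatchPartnerBand

/-!
# Route `KLProgramme` — crux C4a, S3 brick (B4) «(U1)-LAWS» part 6a: the antipodal ϑ-window call WITH THE LOGARITHMIC REMAINDER MAJORISED INTERNALLY —
# twins of `…C4aCausticWindowDispatchPartnerBand` keyed to `…C4aCausticWindowDispatch.intervalIntegral_caustic_dispatch_log_le`

Cell `gate-hubbard-kl`, seat hubbard-kl-k3c3-p3 (g31; row «implicit-function / monotonicity route for μ(n)»).  Located brick for the (C)-closer lane / the (M4)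
assembly of the umklapp first-order ϑ-layer (stub (C) `stub_twoLeg_curvature` of `KLRegimeEngineV17F2`, stmt-HubbardSuperconductivity-20437), memo
HOME/hubbard-kl-k3c3-p3/U1-CAUSTIC-SUP.md §11.

WHY.  The pre-side law of the band (part 5d, `…C4aFoldBoxPreLaw.intervalIntegral_partnerBand_pre_le`) comes with the remainder `B′·log(Γ/|δ₀|)` of the (N2) angle
layer; `…C4aCausticWindowDispatchPartnerBand` (p671031) and the cover theorem (p675052) carry a GENERIC remainder `R` whose integral is left to the caller.  With the
logarithmic remainder the integral is majorised INTERNALLY at the sign pair (p669945 `intervalIntegral_caustic_dispatch_log_le`: two inverse square roots, each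
integrable across its zero uniformly), so the antipodal window is EXPLICIT: `(8A′ + 4P)/√(κ₀/2) + B(β − α) + B′·2(Γ/(κ₀/2))^{1/4}·8√(β − α)`.
* **`intervalIntegral_caustic_dispatch_partnerBand_log_le`** (offset `m` attained/continuous, `|m| ≤ Γ`) and
  **`intervalIntegral_caustic_dispatch_partnerBand_sInf_log_le`** (canonical offset; `|e_K| ≤ K₀ ≤ Γ`).
Composition of landed pieces; nothing new analytically; nothing asserts (C), K3 or superconductivity.
References: FST II CPAM 51 (1998) §3 [cite: FeldmanSalmhoferTrubowitz1998]; Salmhofer 1999 §4.5.3 [cite: Salmhofer1999].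
-/

noncomputable section

namespace Summit.HubbardSuperconductivity.HubbardSuperconductivity.Theorems.C4a

set_option linter.dupNamespace false -- summit = problem name (single-conjunct summit), D-0017

open Real Set MeasureTheory intervalIntegral
open scoped Topology
open Literature.MathematicalPhysics.QuantumLattice Literature.MathematicalPhysics.QuantumLattice.BandSectorCounting Literature.Probability.LatticeModels
open Literature.MathematicalPhysics.QuantumLattice.FermiRG
open Summit.HubbardSuperconductivity.HubbardSuperconductivity.Theorems.KLRegimeSplit
open Summit.HubbardSuperconductivity.HubbardSuperconductivity.Theorems.DispersionFlow
open Summit.HubbardSuperconductivity.HubbardSuperconductivity.Theorems.PerturbedFermiCurve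

section Sizes

variable {K : TrigPolyC4v} {A : ℝ} (hA : ∀ p : Momentum, ∀ j ≤ 2, ‖iteratedFDeriv ℝ j (frameShift K) p‖ ≤ A) (hA20 : A ≤ 1 / 20)
  (hd : klCurveD ≤ (bandBounds (show (-4 : ℝ) < -1.1 by norm_num) (show (-1.1 : ℝ) ≤ -0.1 by norm_num)
    (show (-0.1 : ℝ) < 0 by norm_num)).Dtmin - 2 * A)
  {μ r : ℝ} (hr : 0 < r) (hlo : (-1.1 : ℝ) < μ - r - A) (hhi : μ + r + A < -0.1)
  {A₃ A₄ : ℝ} (hA₃ : ∀ p : Momentum, ‖iteratedFDeriv ℝ 3 (frameShift K) p‖ ≤ A₃)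
  (hA₄ : ∀ p : Momentum, ‖iteratedFDeriv ℝ 4 (frameShift K) p‖ ≤ A₄)
  {K₁ K₂ K₃ : ℝ} (hK₁ : ∀ p : Momentum, ‖fderiv ℝ (frameLevel μ K) p‖ ≤ K₁) (hK₂ : ∀ p : Momentum, ‖iteratedFDeriv ℝ 2 (frameLevel μ K) p‖ ≤ K₂)
  (hK₃ : ∀ p : Momentum, ‖iteratedFDeriv ℝ 3 (frameLevel μ K) p‖ ≤ K₃)
include hA hA20 hd hr hlo hhi hA₃ hA₄ hK₁ hK₂ hK₃

/-- **THE ϑ-LAYER NEAR AN ANTIPODAL-UMKLAPP CONFIGURATION WITH THE LOGARITHMIC REMAINDER MAJORISED INTERNALLY.**  As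
`intervalIntegral_caustic_dispatch_partnerBand_le`, the two laws carrying the remainder `B′·log(Γ/|m ϑ|)` (`|m| ≤ Γ` on the window) instead of a generic `R`;
the dispatcher `…C4aCausticWindowDispatch.intervalIntegral_caustic_dispatch_log_le` majorises the logarithm at the sign pair, so the conclusion is EXPLICIT:
`∫_α^β F ≤ (8A′ + 4P)/√(κ₀/2) + B(β − α) + B′·2(Γ/(κ₀/2))^{1/4}·8√(β − α)`. -/
theorem intervalIntegral_caustic_dispatch_partnerBand_log_le {R : RenConsts} {U : ℝ} {N : ℕ} (hF : FrameOK R U N μ K) {ρ : ℝ} (hρ : |ρ| < r)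
    (c : Momentum) (θ ψ : ℝ) {α β φa φb : ℝ} (hαβ : α ≤ β) {Δ ω : ℝ}
    (hΔ : ∀ x ∈ Icc α β ×ˢ Icc φa φb, ‖c + (levelPoint μ K ρ (x.1 + θ) - levelPoint μ K 0 (x.2 + θ)) - levelPoint μ K 0 ψ‖ ≤ Δ)
    (hω₁ : ∀ ϑ ∈ Icc α β, |ϑ + θ - (ψ + π)| ≤ ω) (hω₂ : ∀ φ ∈ Icc φa φb, |φ + θ - ψ| ≤ ω)
    (hbudget : 2 * (2 * K₃ * Δ * msD A₃ A₄ 1 ^ 2 +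
        4 * K₂ * (radialRowOneConst A ((bandBounds (show (-4 : ℝ) < -1.1 by norm_num) (show (-1.1 : ℝ) ≤ -0.1 by norm_num) (show (-0.1 : ℝ) < 0 by norm_num)).Dtmin - 2 * A) * |ρ| +
          msD A₃ A₄ 2 * ω) * msD A₃ A₄ 1 +
        K₂ * Δ * msD A₃ A₄ 2 +
        K₁ * ((uRowTwoConst A A₃ ((bandBounds (show (-4 : ℝ) < -1.1 by norm_num) (show (-1.1 : ℝ) ≤ -0.1 by norm_num) (show (-0.1 : ℝ) < 0 by norm_num)).Dtmin - 2 * A) +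
              1 / ((bandBounds (show (-4 : ℝ) < -1.1 by norm_num) (show (-1.1 : ℝ) ≤ -0.1 by norm_num) (show (-0.1 : ℝ) < 0 by norm_num)).Dtmin - 2 * A) +
              2 * (radialRowOneConst A ((bandBounds (show (-4 : ℝ) < -1.1 by norm_num) (show (-1.1 : ℝ) ≤ -0.1 by norm_num) (show (-0.1 : ℝ) < 0 by norm_num)).Dtmin - 2 * A) -
                1 / ((bandBounds (show (-4 : ℝ) < -1.1 by norm_num) (show (-1.1 : ℝ) ≤ -0.1 by norm_num) (show (-0.1 : ℝ) < 0 by norm_num)).Dtmin - 2 * A))) * |ρ| +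
            msD A₃ A₄ 3 * ω)) <
      9 / 400 * (bandBounds (show (-4 : ℝ) < -1.1 by norm_num) (show (-1.1 : ℝ) ≤ -0.1 by norm_num) (show (-0.1 : ℝ) < 0 by norm_num)).umin ^ 2)
    {m : ℝ → ℝ} (hcont : ContinuousOn m (Icc α β))
    (hmle : ∀ ϑ ∈ Icc α β, ∀ φ ∈ Icc φa φb, m ϑ ≤ frameLevel μ K (c + (levelPoint μ K ρ (ϑ + θ) - levelPoint μ K 0 (φ + θ))))
    (hmex : ∀ ϑ ∈ Icc α β, ∃ φ ∈ Icc φa φb, m ϑ = frameLevel μ K (c + (levelPoint μ K ρ (ϑ + θ) - levelPoint μ K 0 (φ + θ))))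
    {F : ℝ → ℝ} {lo A' P B B' Γ : ℝ} (hlo' : 0 < lo) (hA' : 0 ≤ A') (hP : 0 ≤ P) (hB : 0 ≤ B) (hB' : 0 ≤ B')
    (hmΓ : ∀ ϑ ∈ Icc α β, |m ϑ| ≤ Γ)
    (hF0 : ∀ ϑ ∈ Icc α β, 0 ≤ F ϑ)
    (hpre : ∀ ϑ ∈ Ioo α β, 0 < m ϑ → F ϑ ≤ A' * (lo * ((max |m ϑ| lo)⁻¹ * (Real.sqrt (max |m ϑ| lo))⁻¹)) + B + B' * Real.log (Γ / |m ϑ|))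
    (hpost : ∀ ϑ ∈ Ioo α β, m ϑ < 0 → F ϑ ≤ P * (Real.sqrt |m ϑ|)⁻¹ + B + B' * Real.log (Γ / |m ϑ|)) :
    ∫ ϑ in α..β, F ϑ ≤ (8 * A' + 4 * P) / Real.sqrt ((9 / 400 * (bandBounds (show (-4 : ℝ) < -1.1 by norm_num) (show (-1.1 : ℝ) ≤ -0.1 by norm_num) (show (-0.1 : ℝ) < 0 by norm_num)).umin ^ 2 -
        2 * (2 * K₃ * Δ * msD A₃ A₄ 1 ^ 2 +
          4 * K₂ * (radialRowOneConst A ((bandBounds (show (-4 : ℝ) < -1.1 by norm_num) (show (-1.1 : ℝ) ≤ -0.1 by norm_num) (show (-0.1 : ℝ) < 0 by norm_num)).Dtmin - 2 * A) * |ρ| +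
            msD A₃ A₄ 2 * ω) * msD A₃ A₄ 1 +
          K₂ * Δ * msD A₃ A₄ 2 +
          K₁ * ((uRowTwoConst A A₃ ((bandBounds (show (-4 : ℝ) < -1.1 by norm_num) (show (-1.1 : ℝ) ≤ -0.1 by norm_num) (show (-0.1 : ℝ) < 0 by norm_num)).Dtmin - 2 * A) +
                1 / ((bandBounds (show (-4 : ℝ) < -1.1 by norm_num) (show (-1.1 : ℝ) ≤ -0.1 by norm_num) (show (-0.1 : ℝ) < 0 by norm_num)).Dtmin - 2 * A) +
                2 * (radialRowOneConst A ((bandBounds (show (-4 : ℝ) < -1.1 by norm_num) (show (-1.1 : ℝ) ≤ -0.1 by norm_num) (show (-0.1 : ℝ) < 0 by norm_num)).Dtmin - 2 * A) -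
                  1 / ((bandBounds (show (-4 : ℝ) < -1.1 by norm_num) (show (-1.1 : ℝ) ≤ -0.1 by norm_num) (show (-0.1 : ℝ) < 0 by norm_num)).Dtmin - 2 * A))) * |ρ| +
              msD A₃ A₄ 3 * ω))) / 2) +
      B * (β - α) + B' * (2 * (Γ / ((9 / 400 * (bandBounds (show (-4 : ℝ) < -1.1 by norm_num) (show (-1.1 : ℝ) ≤ -0.1 by norm_num) (show (-0.1 : ℝ) < 0 by norm_num)).umin ^ 2 -
        2 * (2 * K₃ * Δ * msD A₃ A₄ 1 ^ 2 +
          4 * K₂ * (radialRowOneConst A ((bandBounds (show (-4 : ℝ) < -1.1 by norm_num) (show (-1.1 : ℝ) ≤ -0.1 by norm_num) (show (-0.1 : ℝ) < 0 by norm_num)).Dtmin - 2 * A) * |ρ| +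
            msD A₃ A₄ 2 * ω) * msD A₃ A₄ 1 +
          K₂ * Δ * msD A₃ A₄ 2 +
          K₁ * ((uRowTwoConst A A₃ ((bandBounds (show (-4 : ℝ) < -1.1 by norm_num) (show (-1.1 : ℝ) ≤ -0.1 by norm_num) (show (-0.1 : ℝ) < 0 by norm_num)).Dtmin - 2 * A) +
                1 / ((bandBounds (show (-4 : ℝ) < -1.1 by norm_num) (show (-1.1 : ℝ) ≤ -0.1 by norm_num) (show (-0.1 : ℝ) < 0 by norm_num)).Dtmin - 2 * A) +
                2 * (radialRowOneConst A ((bandBounds (show (-4 : ℝ) < -1.1 by norm_num) (show (-1.1 : ℝ) ≤ -0.1 by norm_num) (show (-0.1 : ℝ) < 0 by norm_num)).Dtmin - 2 * A) -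
                  1 / ((bandBounds (show (-4 : ℝ) < -1.1 by norm_num) (show (-1.1 : ℝ) ≤ -0.1 by norm_num) (show (-0.1 : ℝ) < 0 by norm_num)).Dtmin - 2 * A))) * |ρ| +
              msD A₃ A₄ 3 * ω))) / 2)) ^ (1 / 4 : ℝ)) * (8 * Real.sqrt (β - α)) := by
  set B₀ := bandBounds (show (-4 : ℝ) < -1.1 by norm_num) (show (-1.1 : ℝ) ≤ -0.1 by norm_num) (show (-0.1 : ℝ) < 0 by norm_num) with hB₀
  set ε : ℝ := 2 * K₃ * Δ * msD A₃ A₄ 1 ^ 2 +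
      4 * K₂ * (radialRowOneConst A (B₀.Dtmin - 2 * A) * |ρ| + msD A₃ A₄ 2 * ω) * msD A₃ A₄ 1 + K₂ * Δ * msD A₃ A₄ 2 +
      K₁ * ((uRowTwoConst A A₃ (B₀.Dtmin - 2 * A) + 1 / (B₀.Dtmin - 2 * A) + 2 * (radialRowOneConst A (B₀.Dtmin - 2 * A) - 1 / (B₀.Dtmin - 2 * A))) * |ρ| +
        msD A₃ A₄ 3 * ω) with hε
  set κ₀ : ℝ := 9 / 400 * B₀.umin ^ 2 - 2 * ε with hκ₀
  have hκ₀pos : 0 < κ₀ := by rw [hκ₀]; linarith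
  have hbudget' : ε ≤ 3 / 2 * (3 / 200 * B₀.umin ^ 2) := by
    have hε0 : 9 / 400 * B₀.umin ^ 2 - 2 * ε > 0 := hκ₀pos
    -- `ε < (9/800)u² ≤ (9/400)u²`
    nlinarith [sq_nonneg B₀.umin]
  -- (i) joint strong convexity on the box
  have hS : Convex ℝ (Icc α β ×ˢ Icc φa φb) := (convex_Icc α β).prod (convex_Icc φa φb)
  have hconv := convexOn_partnerBand_antipodal_sub_sq hA hA20 hd hr hlo hhi hA₃ hA₄ hK₁ hK₂ hK₃ hF hρ c θ ψ hS hΔ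
    (fun x hx => hω₁ x.1 hx.1) (fun x hx => hω₂ x.2 hx.2) hbudget'
  -- (ii) the attained minimum inherits the modulus
  have hm : ConvexOn ℝ (Icc α β) (fun ϑ => m ϑ - κ₀ / 2 * ϑ ^ 2) :=
    convexOn_min_sub_sq_of_exists (g := fun ϑ φ => frameLevel μ K (c + (levelPoint μ K ρ (ϑ + θ) - levelPoint μ K 0 (φ + θ))))
      hconv (convex_Icc α β) (convex_Icc φa φb) hmle hmex
  -- (iii) the dispatcher
  have hΓ : 0 ≤ Γ := (abs_nonneg _).trans (hmΓ α (left_mem_Icc.2 hαβ))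
  exact intervalIntegral_caustic_dispatch_log_le hαβ hκ₀pos hlo' hA' hP hB hB' hΓ hm hcont hmΓ hF0 hpre hpost


/-- **THE SAME WITH THE CANONICAL OFFSET** `δ₀(ϑ) = inf_{φ ∈ [φa,φb]} e_K(c + Φ(ρ,ϑ+θ) − Φ(0,φ+θ))` and the height `|e_K| ≤ K₀ ≤ Γ` discharging `|δ₀| ≤ Γ`. -/
theorem intervalIntegral_caustic_dispatch_partnerBand_sInf_log_le {R : RenConsts} {U : ℝ} {N : ℕ} (hF : FrameOK R U N μ K) {ρ : ℝ} (hρ : |ρ| < r)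
    (c : Momentum) (θ ψ : ℝ) {α β φa φb : ℝ} (hαβ : α ≤ β) (hφ : φa ≤ φb) {Δ ω : ℝ}
    (hΔ : ∀ x ∈ Icc α β ×ˢ Icc φa φb, ‖c + (levelPoint μ K ρ (x.1 + θ) - levelPoint μ K 0 (x.2 + θ)) - levelPoint μ K 0 ψ‖ ≤ Δ)
    (hω₁ : ∀ ϑ ∈ Icc α β, |ϑ + θ - (ψ + π)| ≤ ω) (hω₂ : ∀ φ ∈ Icc φa φb, |φ + θ - ψ| ≤ ω)
    (hbudget : 2 * (2 * K₃ * Δ * msD A₃ A₄ 1 ^ 2 +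
        4 * K₂ * (radialRowOneConst A ((bandBounds (show (-4 : ℝ) < -1.1 by norm_num) (show (-1.1 : ℝ) ≤ -0.1 by norm_num) (show (-0.1 : ℝ) < 0 by norm_num)).Dtmin - 2 * A) * |ρ| +
          msD A₃ A₄ 2 * ω) * msD A₃ A₄ 1 +
        K₂ * Δ * msD A₃ A₄ 2 +
        K₁ * ((uRowTwoConst A A₃ ((bandBounds (show (-4 : ℝ) < -1.1 by norm_num) (show (-1.1 : ℝ) ≤ -0.1 by norm_num) (show (-0.1 : ℝ) < 0 by norm_num)).Dtmin - 2 * A) +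
              1 / ((bandBounds (show (-4 : ℝ) < -1.1 by norm_num) (show (-1.1 : ℝ) ≤ -0.1 by norm_num) (show (-0.1 : ℝ) < 0 by norm_num)).Dtmin - 2 * A) +
              2 * (radialRowOneConst A ((bandBounds (show (-4 : ℝ) < -1.1 by norm_num) (show (-1.1 : ℝ) ≤ -0.1 by norm_num) (show (-0.1 : ℝ) < 0 by norm_num)).Dtmin - 2 * A) -
                1 / ((bandBounds (show (-4 : ℝ) < -1.1 by norm_num) (show (-1.1 : ℝ) ≤ -0.1 by norm_num) (show (-0.1 : ℝ) < 0 by norm_num)).Dtmin - 2 * A))) * |ρ| +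
            msD A₃ A₄ 3 * ω)) <
      9 / 400 * (bandBounds (show (-4 : ℝ) < -1.1 by norm_num) (show (-1.1 : ℝ) ≤ -0.1 by norm_num) (show (-0.1 : ℝ) < 0 by norm_num)).umin ^ 2)
    {F : ℝ → ℝ} {lo A' P B B' Γ K₀ : ℝ} (hlo' : 0 < lo) (hA' : 0 ≤ A') (hP : 0 ≤ P) (hB : 0 ≤ B) (hB' : 0 ≤ B')
    (hK₀ : ∀ p : Momentum, |frameLevel μ K p| ≤ K₀) (hK₀Γ : K₀ ≤ Γ)
    (hF0 : ∀ ϑ ∈ Icc α β, 0 ≤ F ϑ)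
    (hpre : ∀ ϑ ∈ Ioo α β, 0 < sInf ((fun φ => frameLevel μ K (c + (levelPoint μ K ρ (ϑ + θ) - levelPoint μ K 0 (φ + θ)))) '' Icc φa φb) →
      F ϑ ≤ A' * (lo * ((max |sInf ((fun φ => frameLevel μ K (c + (levelPoint μ K ρ (ϑ + θ) - levelPoint μ K 0 (φ + θ)))) '' Icc φa φb)| lo)⁻¹ *
        (Real.sqrt (max |sInf ((fun φ => frameLevel μ K (c + (levelPoint μ K ρ (ϑ + θ) - levelPoint μ K 0 (φ + θ)))) '' Icc φa φb)| lo))⁻¹)) + B + B' * Real.log (Γ / |sInf ((fun φ => frameLevel μ K (c + (levelPoint μ K ρ (ϑ + θ) - levelPoint μ K 0 (φ + θ)))) '' Icc φa φb)|))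
    (hpost : ∀ ϑ ∈ Ioo α β, sInf ((fun φ => frameLevel μ K (c + (levelPoint μ K ρ (ϑ + θ) - levelPoint μ K 0 (φ + θ)))) '' Icc φa φb) < 0 →
      F ϑ ≤ P * (Real.sqrt |sInf ((fun φ => frameLevel μ K (c + (levelPoint μ K ρ (ϑ + θ) - levelPoint μ K 0 (φ + θ)))) '' Icc φa φb)|)⁻¹ + B + B' * Real.log (Γ / |sInf ((fun φ => frameLevel μ K (c + (levelPoint μ K ρ (ϑ + θ) - levelPoint μ K 0 (φ + θ)))) '' Icc φa φb)|)) :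
    ∫ ϑ in α..β, F ϑ ≤ (8 * A' + 4 * P) / Real.sqrt ((9 / 400 * (bandBounds (show (-4 : ℝ) < -1.1 by norm_num) (show (-1.1 : ℝ) ≤ -0.1 by norm_num) (show (-0.1 : ℝ) < 0 by norm_num)).umin ^ 2 -
        2 * (2 * K₃ * Δ * msD A₃ A₄ 1 ^ 2 +
          4 * K₂ * (radialRowOneConst A ((bandBounds (show (-4 : ℝ) < -1.1 by norm_num) (show (-1.1 : ℝ) ≤ -0.1 by norm_num) (show (-0.1 : ℝ) < 0 by norm_num)).Dtmin - 2 * A) * |ρ| +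
            msD A₃ A₄ 2 * ω) * msD A₃ A₄ 1 +
          K₂ * Δ * msD A₃ A₄ 2 +
          K₁ * ((uRowTwoConst A A₃ ((bandBounds (show (-4 : ℝ) < -1.1 by norm_num) (show (-1.1 : ℝ) ≤ -0.1 by norm_num) (show (-0.1 : ℝ) < 0 by norm_num)).Dtmin - 2 * A) +
                1 / ((bandBounds (show (-4 : ℝ) < -1.1 by norm_num) (show (-1.1 : ℝ) ≤ -0.1 by norm_num) (show (-0.1 : ℝ) < 0 by norm_num)).Dtmin - 2 * A) +
                2 * (radialRowOneConst A ((bandBounds (show (-4 : ℝ) < -1.1 by norm_num) (show (-1.1 : ℝ) ≤ -0.1 by norm_num) (show (-0.1 : ℝ) < 0 by norm_num)).Dtmin - 2 * A) -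
                  1 / ((bandBounds (show (-4 : ℝ) < -1.1 by norm_num) (show (-1.1 : ℝ) ≤ -0.1 by norm_num) (show (-0.1 : ℝ) < 0 by norm_num)).Dtmin - 2 * A))) * |ρ| +
              msD A₃ A₄ 3 * ω))) / 2) +
      B * (β - α) + B' * (2 * (Γ / ((9 / 400 * (bandBounds (show (-4 : ℝ) < -1.1 by norm_num) (show (-1.1 : ℝ) ≤ -0.1 by norm_num) (show (-0.1 : ℝ) < 0 by norm_num)).umin ^ 2 -
        2 * (2 * K₃ * Δ * msD A₃ A₄ 1 ^ 2 +
          4 * K₂ * (radialRowOneConst A ((bandBounds (show (-4 : ℝ) < -1.1 by norm_num) (show (-1.1 : ℝ) ≤ -0.1 by norm_num) (show (-0.1 : ℝ) < 0 by norm_num)).Dtmin - 2 * A) * |ρ| +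
            msD A₃ A₄ 2 * ω) * msD A₃ A₄ 1 +
          K₂ * Δ * msD A₃ A₄ 2 +
          K₁ * ((uRowTwoConst A A₃ ((bandBounds (show (-4 : ℝ) < -1.1 by norm_num) (show (-1.1 : ℝ) ≤ -0.1 by norm_num) (show (-0.1 : ℝ) < 0 by norm_num)).Dtmin - 2 * A) +
                1 / ((bandBounds (show (-4 : ℝ) < -1.1 by norm_num) (show (-1.1 : ℝ) ≤ -0.1 by norm_num) (show (-0.1 : ℝ) < 0 by norm_num)).Dtmin - 2 * A) +
                2 * (radialRowOneConst A ((bandBounds (show (-4 : ℝ) < -1.1 by norm_num) (show (-1.1 : ℝ) ≤ -0.1 by norm_num) (show (-0.1 : ℝ) < 0 by norm_num)).Dtmin - 2 * A) -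
                  1 / ((bandBounds (show (-4 : ℝ) < -1.1 by norm_num) (show (-1.1 : ℝ) ≤ -0.1 by norm_num) (show (-0.1 : ℝ) < 0 by norm_num)).Dtmin - 2 * A))) * |ρ| +
              msD A₃ A₄ 3 * ω))) / 2)) ^ (1 / 4 : ℝ)) * (8 * Real.sqrt (β - α)) := by
  set B₀ := bandBounds (show (-4 : ℝ) < -1.1 by norm_num) (show (-1.1 : ℝ) ≤ -0.1 by norm_num) (show (-0.1 : ℝ) < 0 by norm_num) with hB₀
  have hADt : 2 * A < B₀.Dtmin := by have := klCurveD_pos; linarith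
  have h0 : |(0 : ℝ)| < r := by simpa using hr
  -- the family is jointly continuous
  set g : ℝ → ℝ → ℝ := fun ϑ φ => frameLevel μ K (c + (levelPoint μ K ρ (ϑ + θ) - levelPoint μ K 0 (φ + θ))) with hg
  have hcρ : Continuous (levelPoint μ K ρ) := (contDiff_levelPoint_angle B₀ hA hADt hlo hhi hρ (m := 0)).continuous
  have hc0 : Continuous (levelPoint μ K 0) := (contDiff_levelPoint_angle B₀ hA hADt hlo hhi h0 (m := 0)).continuous
  have hjoint : Continuous ↿g := by
    have h1 : Continuous fun p : ℝ × ℝ => c + (levelPoint μ K ρ (p.1 + θ) - levelPoint μ K 0 (p.2 + θ)) :=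
      continuous_const.add ((hcρ.comp (continuous_fst.add continuous_const)).sub (hc0.comp (continuous_snd.add continuous_const)))
    exact (EngineV8.contDiff_frameLevel μ K (n := 0)).continuous.comp h1
  have hcont : ContinuousOn (fun ϑ => sInf (g ϑ '' Icc φa φb)) (Icc α β) := ((isCompact_Icc).continuous_sInf hjoint).continuousOn
  have hslice : ∀ ϑ : ℝ, ContinuousOn (g ϑ) (Icc φa φb) := fun ϑ =>
    ((EngineV8.contDiff_frameLevel μ K (n := 0)).continuous.comp
      (continuous_const.add (continuous_const.sub (hc0.comp (continuous_id.add continuous_const))))).continuousOn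
  have hmin : ∀ ϑ ∈ Icc α β, (∀ φ ∈ Icc φa φb, sInf (g ϑ '' Icc φa φb) ≤ g ϑ φ) ∧ ∃ φ ∈ Icc φa φb, sInf (g ϑ '' Icc φa φb) = g ϑ φ := fun ϑ _ => by
    obtain ⟨x, hx, hxeq, hxle⟩ := isCompact_Icc.exists_sInf_image_eq_and_le (nonempty_Icc.2 hφ) (hslice ϑ)
    exact ⟨fun φ hφ' => hxeq ▸ hxle φ hφ', x, hx, hxeq⟩
  have hmΓ : ∀ ϑ ∈ Icc α β, |sInf (g ϑ '' Icc φa φb)| ≤ Γ := fun ϑ hϑ => by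
    obtain ⟨φ, -, hφeq⟩ := (hmin ϑ hϑ).2
    rw [hφeq]; exact (hK₀ _).trans hK₀Γ
  exact intervalIntegral_caustic_dispatch_partnerBand_log_le hA hA20 hd hr hlo hhi hA₃ hA₄ hK₁ hK₂ hK₃ hF hρ c θ ψ hαβ hΔ hω₁ hω₂ hbudget hcont
    (fun ϑ hϑ => (hmin ϑ hϑ).1) (fun ϑ hϑ => (hmin ϑ hϑ).2) hlo' hA' hP hB hB' hmΓ hF0 hpre hpost


end Sizes

end Summit.HubbardSuperconductivity.HubbardSuperconductivity.Theorems.C4a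

end
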